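import Summits.Ventures.QEC.CircuitDistance.ETowerIdentZ
import Summits.Ventures.QEC.CircuitDistance.ETowerTop
import HarnessLib

/-!
# P3-PORT STEP 2 (E-fold tower), sector Z: SOUNDNESS OF THE K-FILE CONTINUATIONS `ktop / nodeC / nodeB / nodeA` and of the
# WINDOW scheme (ASSEMBLY-SPEC §B6, §B7; cell `qec`, experiment CDX, seat qec-cdx-type-1)

Over eng-1's `ETowerKZ` (prototype shapes: `ktop = ktopG …`, `nodeC = nodeGdG …` by `rfl`) and the identities of `ETowerIdentZ`:
the nested predicates `QT` (top), `NC`, `NB` and the facts the composed tower `kc_of_tower` consumes —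
`hktopZ`, `hkCZ` (given the weight-3 classes `W3C` certified: `hW3`), `hkBZ`, `hkAZ`, the closures `hNCZ / hNBZ`, and
`hW3_of_winsZ`: the 4 × 8 window facts (eng-1's `ETowerWinZ*`: `nodeCW (W3L.getD k []) (W3WIN3.getD j (0,0)) = true`) give `hW3`
(cover / bounds / `W3C = W3L.map maskOf` decided here).  No `native_decide`; nothing here asserts a value of `d_circ`.
-/

set_option maxRecDepth 100000
set_option exponentiation.threshold 1024

namespace Summit.Ventures.QEC.CircuitDistance.ETower.SecZ

open Summit.Ventures.QEC.Census Summit.Ventures.QEC.Census.Fold Summit.Ventures.QEC.CircuitDistance.ETower K2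

/-! ## The nested predicates -/

/-- TOP predicate of sector Z: kernel word ⇒ all logical parities (record `lg`) vanish, or an anchored translate is in `TOPS`. -/
def QT : ℕ → Prop := QTop 12 6 5 col0 lgR TOPS
/-- level-C fibre property of a 180-slot word of E₁. -/
def NC : ℕ → Prop := GoodFibK GC 5 col0 9 QT
/-- level-B fibre property of a 90-slot word of E₂. -/
def NB : ℕ → Prop := GoodFibK GB 5 col1 9 NC

/-- `QT` is closed under un-translating. -/
theorem hQTZ : ∀ da db u, QT (transWK GC.l GC.m 5 da db u) → QT u := hQT TOPS
/-- `NC` is closed under un-translating (small torus of C = big torus of B). -/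
theorem hNCZ : ∀ da db v, NC (transWK GB.l GB.m 5 da db v) → NC v :=
  fun da db v h => goodFibK_transWK_closed shapeC okC hK0 hQTZ da db v h
/-- `NB` is closed under un-translating. -/
theorem hNBZ : ∀ da db v, NB (transWK GA.l GA.m 5 da db v) → NB v :=
  fun da db v h => goodFibK_transWK_closed shapeB okB hK1 hNCZ da db v h

/-! ## The logical table of the K file is the record's -/

/-- KERNEL: `TLG` = record `lg` on all 360 slots. -/
theorem tlg_eqZ : ((List.range 360).all fun J => tab TLG 12 J == lgR J) = true := by decide +kernel
/-- unpacked. -/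
theorem hTLGZ : ∀ J, J < 5 * (12 * 6) → tab TLG 12 J = lgR J := fun J hJ => by
  have := List.all_eq_true.1 tlg_eqZ J (List.mem_range.2 hJ); rwa [beq_iff_eq] at this

/-! ## Soundness of the continuations -/

/-- `ktop` is the generic shape. -/
theorem ktop_eqZ (S : List ℕ) : ktop S = ktopG 12 6 (fun j => tab TLG 12 j) md0 TOPS S := rfl
/-- `nodeC` is the generic guarded shape. -/
theorem nodeC_eqZ (S : List ℕ) :
    nodeC S = nodeGdG GC 180 (tab TFC 72) (tab TPC 72) 9 ktop (fun S => decide (S.length ≤ 3)) md0 W3C S := rfl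

/-- **`ktop` soundness.** -/
theorem hktopZ : ∀ S, (∀ J ∈ S, J < nK GC 5) → S.length = popc (nK GC 5) (maskOf S) → ktop S = true → QT (maskOf S) := by
  intro S hS _ h
  rw [ktop_eqZ] at h
  exact ktopG_sound (nb := 5) (syn := col0) hTLGZ hS h

/-- **`nodeC` soundness**, given the weight-3 classes certified. -/
theorem hkCZ (hW3 : ∀ r ∈ W3C, NC r) : ∀ S, (∀ j ∈ S, j < nsK GC 5) → nodeC S = true → NC (maskOf S) := by
  intro S hS h
  rw [nodeC_eqZ] at h
  exact nodeGdG_sound shapeC okC hK0 hMC hMpC hQTZ hktopZ hW3 hS h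

/-- **`nodeB` soundness.** -/
theorem hkBZ (hW3 : ∀ r ∈ W3C, NC r) : ∀ S, (∀ j ∈ S, j < nsK GB 5) → nodeB S = true → NB (maskOf S) := by
  intro S hS h
  exact nodeK_sound shapeB okB (hK1 GB.gen.1 GB.gen.2) hMB hMpB (hNCZ GB.gen.1 GB.gen.2) (fun S' hS' _ h' => hkCZ hW3 S' hS' h') hS h

/-- **`nodeA` soundness.** -/
theorem hkAZ (hW3 : ∀ r ∈ W3C, NC r) : ∀ S, (∀ j ∈ S, j < nsK GA 5) → nodeA S = true → GoodFibK GA 5 col2 9 NB (maskOf S) := by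
  intro S hS h
  exact nodeK_sound shapeA okA (hK2 GA.gen.1 GA.gen.2) hMA hMpA (hNBZ GA.gen.1 GA.gen.2) (fun S' hS' _ h' => hkBZ hW3 S' hS' h') hS h

/-! ## The windows give the weight-3 classes -/

/-- KERNEL: the window family has a window starting at 0, covers every outside position of every `W3L` word, the words are in
the window, and `W3C` lists exactly their masks. -/
theorem winCoverZ :
    (decide (∃ w ∈ W3WIN3, w.1 = 0) &&
     decide (W3C = W3L.map maskOf) &&
     (W3L.all fun L => (L.all fun j => decide (j < 180)) &&
       (List.range (outsideOf 180 (bitsOf 180 0 (maskOf L))).length).all fun p =>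
         W3WIN3.any fun w => decide (w.1 ≤ p) && decide (p < w.2))) = true := by
  decide +kernel

/-- **The 4 × 8 window facts certify the weight-3 classes**: `hW3`. -/
theorem hW3_of_winsZ (hwin : ∀ L ∈ W3L, ∀ w ∈ W3WIN3, nodeCW L w = true) : ∀ r ∈ W3C, NC r := by
  have h := winCoverZ
  rw [Bool.and_eq_true, Bool.and_eq_true, decide_eq_true_eq, decide_eq_true_eq, List.all_eq_true] at h
  obtain ⟨⟨hzero, hW3C⟩, hall⟩ := h
  intro r hr
  rw [hW3C, List.mem_map] at hr
  obtain ⟨L, hL, rfl⟩ := hr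
  have hLall := hall L hL
  rw [Bool.and_eq_true, List.all_eq_true, List.all_eq_true] at hLall
  obtain ⟨hbnd, hcov⟩ := hLall
  have hSb : ∀ j ∈ L, j < nsK GC 5 := fun j hj => by
    have := hbnd j hj; rw [decide_eq_true_eq] at this; exact lt_of_lt_of_eq this (by decide)
  refine nodeKW_sound okC hMC hMpC (k := ktop) (Q := QT) hktopZ hSb W3WIN3 hzero ?_ ?_
  · intro p hp
    have hp' : p < (outsideOf 180 (bitsOf 180 0 (maskOf L))).length := by
      have e : nsK GC 5 = 180 := by decide
      rwa [e] at hp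
    have := hcov p (List.mem_range.2 hp')
    rw [List.any_eq_true] at this
    obtain ⟨w, hw, hw'⟩ := this
    rw [Bool.and_eq_true, decide_eq_true_eq, decide_eq_true_eq] at hw'
    exact ⟨w, hw, hw'.1, hw'.2⟩
  · intro w hw
    exact hwin L hL w hw

end Summit.Ventures.QEC.CircuitDistance.ETower.SecZ
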